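import Literature.Computability.AlgebraicComplexity.BorderRankCWDet3Seventeen
import Literature.Computability.AlgebraicComplexity.BorderRankSkewCW
import HarnessLib

/-!
# The border rank of the cube of the skew Coppersmith–Winograd tensor is at most 84

`Summit.MatrixMultiplication.MatrixMultiplication.Theorems` — solo programme `solo-MatrixMultiplication-blind`.

Let `T = T_{skewcw,2} ∈ ℂ³⊗ℂ³⊗ℂ³` (`skewCwTensor ℂ 1`; up to signs and a relabelling of the third factor it
is the Levi-Civita tensor `S = e₀∧e₁∧e₂`).  Known: `bR(T) = 5` [ConnerGesmundoLandsbergVentura2022,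
Prop. 3.1], `bR(T^{⊠2}) = bR(det₃) = 17` [ConnerGesmundoLandsbergVentura2022, Thm. 2.7;
ConnerHarperLandsberg2019], hence `bR(T^{⊠3}) ≤ 5·17 = 85`, while Koszul flattenings give `bR(T^{⊠3}) ≥ 49`
[ConnerHuangLandsberg2020, Thm. 4.1]; "the problem of determining the border rank of the cube remains"
(Landsberg, *Secant varieties and the complexity of matrix multiplication*, Rend. Istit. Mat. Univ. Trieste 54
(2022), §5; companion of [Landsberg2022SecantSurvey]).  We prove

  `bR(T_{skewcw,2}^{⊠3}) ≤ 84 < 85`,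

by an explicit approximate decomposition of order `12` with `84` monomial triads, kernel-checked.  No new
definition enters the tree with this file: all data are local notations.

## The construction (junk cancellation + torus + one rank-14 block)

Write `S^{⊠3} = S(A) ⊠ S(B) ⊠ S(C)` and view `S(B) ⊠ S(C)` as the `3×3` determinant on `V = B⊗C`
(rows `b`, columns `c`): `det₃ = ∑_π sgn π · X_π` where `X_π ⊂ V^{⊗3}` is the copy of `T_xyz` supported on
the permutation pattern `{(0,π0),(1,π1),(2,π2)}`.  Let `Z ∈ (A⊗ℂ³)^{⊗3}` be ANY tensor which
 (i) agrees with `S(A) ⊗ T_xyz` on the entries whose `ℂ³`-pattern is a transversal,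
 (ii) vanishes on the `ℂ³`-patterns `{0,0,1},{0,0,2},{0,1,1}` (and permutations), and is
 (iii) arbitrary on the diagonal patterns `{v,v,v}` ("column junk") and on `{1,1,2},{0,2,2},{1,2,2}`.
Embedding `Z` along the six permutation patterns, `P := ∑_π sgn π · ι_π(Z)` has rank `≤ 6·R(Z)`; the column
junk cancels in the alternating sum (an entry with all three `V`-indices in one column `c` receives
`∑_{π : π(b)=c} sgn π · J = 0`), and under the torus `t ↦ diag(t^{3(b-1)+(c-1)})` on `V` (trivial on `A`) every
surviving non-target entry of `P` has positive weight while `S^{⊠3}` has weight `0`.  Hence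
`bR(S^{⊠3}) ≤ 6·R(Z)`, and `R(Z) ≤ 14` is witnessed by the integer tables `𝔹u, 𝔹v, 𝔹w` below, found by
Levenberg–Marquardt search followed by exact rationalisation inside the ansatz
`Z = ½·D₅ ⊗ (e₀-e₂)^{⊗3} + ∑_{s=1}^{9} ⊗_{ℓ=1}^{3} (x_s^ℓ ⊗ (e₀+e₁) + x'_s^ℓ ⊗ e₂)`
(`D₅` = Derksen's five-term expression of `S`, arXiv:2303.07845; the nine terms solve
`∑ x¹⊗x²⊗x³ = 0`, `∑ x'¹⊗x²⊗x³ = ∑ x¹⊗x'²⊗x³ = ∑ x¹⊗x²⊗x'³ = S`).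
The file only uses the end product: `84 = 6·14` monomial triads whose coefficients are read off the block
tables, and ONE integer identity per entry of the `27×27×27` cube, verified by `decide +kernel`.

Indexing: an index of `T^{⊠3}` is `a : Fin 3 → Fin 3`, `a 0` the `A`-digit, `a 1` the `B`-digit (row), `a 2` the
`C`-digit (column).  The twist `T(i,j,k) = sgnB j · sgnC k · S(i,j,γ k)` of `CHL17` is applied factorwise.
-/

open scoped BigOperators Polynomial

open Literature.Computability.AlgebraicComplexity
open Literature.Computability.AlgebraicComplexity.CHL17 (skewZ sgnB sgnC gam skewCwTensor_one_eq_cast)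

set_option linter.dupNamespace false

namespace Summit.MatrixMultiplication.MatrixMultiplication.Theorems

section Generic

/-- Coefficients of a product of three monomials. [new] -/
theorem coeff_monomial_triad (x y z : ℂ) (i j k d : ℕ) :
    (Polynomial.C x * Polynomial.X ^ i * (Polynomial.C y * Polynomial.X ^ j) *
        (Polynomial.C z * Polynomial.X ^ k)).coeff d =
      if d = i + j + k then x * y * z else 0 := by
  rw [show Polynomial.C x * Polynomial.X ^ i * (Polynomial.C y * Polynomial.X ^ j) *
        (Polynomial.C z * Polynomial.X ^ k) = Polynomial.C (x * y * z) * Polynomial.X ^ (i + j + k) by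
      simp only [map_mul, pow_add]; ring,
    Polynomial.coeff_C_mul_X_pow]

/-- **Generic transport.** Integer coefficient tables `U V W` indexed by `Fin m × Fin n` (re-indexed by
`e : Fin r ≃ Fin m × Fin n`), exponent functions `eU eV eW`, a common denominator `L ≠ 0` and an
integer model `Tz` of the target `T`: if for every entry the coefficients cancel in total degree `< h`,
equal `L · Tz` in degree `h`, and `Tz` vanishes off degree `h`, then the monomial triads
`(U/L) t^{eU} ⊗ V t^{eV} ⊗ W t^{eW}` form an order-`h` approximate decomposition of `T`. [new] -/
theorem isApproxDecomposition_of_entrywise {α β γ : Type*} {m n r h : ℕ} (e : Fin r ≃ Fin m × Fin n)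
    (U : Fin m → Fin n → α → ℤ) (V : Fin m → Fin n → β → ℤ) (W : Fin m → Fin n → γ → ℤ)
    (eU : α → ℕ) (eV : β → ℕ) (eW : γ → ℕ) (L : ℤ) (hL : L ≠ 0)
    (T : α → β → γ → ℂ) (Tz : α → β → γ → ℤ) (hT : ∀ a b c, T a b c = (Tz a b c : ℂ))
    (hlow : ∀ a b c, eU a + eV b + eW c < h → ∑ π, ∑ s, U π s a * V π s b * W π s c = 0)
    (htop : ∀ a b c, eU a + eV b + eW c = h → ∑ π, ∑ s, U π s a * V π s b * W π s c = L * Tz a b c)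
    (hoff : ∀ a b c, eU a + eV b + eW c ≠ h → Tz a b c = 0) :
    IsApproxDecomposition h T
      (fun ρ a => Polynomial.C (((U (e ρ).1 (e ρ).2 a : ℤ) : ℂ) / (L : ℂ)) * Polynomial.X ^ eU a)
      (fun ρ b => Polynomial.C ((V (e ρ).1 (e ρ).2 b : ℤ) : ℂ) * Polynomial.X ^ eV b)
      (fun ρ c => Polynomial.C ((W (e ρ).1 (e ρ).2 c : ℤ) : ℂ) * Polynomial.X ^ eW c) := by
  intro a b c d hd
  rw [Polynomial.finsetSum_coeff]
  simp only [coeff_monomial_triad]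
  have hL' : (L : ℂ) ≠ 0 := by exact_mod_cast hL
  -- the degree-`d` coefficient sum, when `d` is the common degree
  have key : ∑ ρ : Fin r, ((U (e ρ).1 (e ρ).2 a : ℤ) : ℂ) / (L : ℂ) * ((V (e ρ).1 (e ρ).2 b : ℤ) : ℂ) *
      ((W (e ρ).1 (e ρ).2 c : ℤ) : ℂ) =
      ((∑ π, ∑ s, U π s a * V π s b * W π s c : ℤ) : ℂ) / (L : ℂ) := by
    have h1 : ∑ ρ : Fin r, ((U (e ρ).1 (e ρ).2 a : ℤ) : ℂ) / (L : ℂ) * ((V (e ρ).1 (e ρ).2 b : ℤ) : ℂ) *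
        ((W (e ρ).1 (e ρ).2 c : ℤ) : ℂ) =
        ∑ p : Fin m × Fin n, ((U p.1 p.2 a * V p.1 p.2 b * W p.1 p.2 c : ℤ) : ℂ) / (L : ℂ) :=
      Fintype.sum_equiv e _ _ (fun ρ => by push_cast; ring)
    rw [h1, Fintype.sum_prod_type]
    push_cast
    simp only [Finset.sum_div]
  by_cases hdeg : d = eU a + eV b + eW c
  · simp only [hdeg, if_true]
    rw [key]
    by_cases hdh : eU a + eV b + eW c = h
    · rw [hdh, if_pos rfl, htop a b c hdh, hT]
      push_cast
      field_simp
    · have hlt : eU a + eV b + eW c < h := lt_of_le_of_ne (hdeg ▸ hd) hdh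
      rw [hlow a b c hlt, if_neg hdh]
      simp
  · simp only [hdeg, if_false, Finset.sum_const_zero]
    by_cases hdh : d = h
    · subst hdh
      rw [if_pos rfl, hT, hoff a b c (fun h' => hdeg h'.symm)]
      simp
    · rw [if_neg hdh]

end Generic

section SkewCube84

/-- First-factor block table `𝔹u s a0 v` (coefficient of `e_{a0} ⊗ e_v` in the first leg of block term `s`,
pre-multiplied by the common denominator `576`); local notation. -/
local notation "𝔹u" => (
  ![![![0, 0, 0], ![288, 0, -288], ![288, 0, -288]],
    ![![288, 0, -288], ![288, 0, -288], ![0, 0, 0]],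
    ![![0, 0, 0], ![576, 0, -576], ![0, 0, 0]],
    ![![0, 0, 0], ![-288, 0, 288], ![288, 0, -288]],
    ![![288, 0, -288], ![-288, 0, 288], ![0, 0, 0]],
    ![![-2, -2, -32], ![-9, -9, -144], ![0, 0, 0]],
    ![![-6, -6, 96], ![9, 9, 0], ![-18, -18, 288]],
    ![![0, 0, 0], ![-54, -54, 0], ![36, 36, 0]],
    ![![0, 0, 0], ![-18, -18, 432], ![18, 18, -288]],
    ![![6, 6, -96], ![9, 9, -432], ![0, 0, 0]],
    ![![12, 12, 0], ![0, 0, 0], ![36, 36, 0]],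
    ![![0, 0, 0], ![-6, -6, 0], ![0, 0, 0]],
    ![![0, 0, 0], ![6, 6, 288], ![0, 0, 0]],
    ![![4, 4, -128], ![0, 0, -288], ![0, 0, 0]]] : Fin 14 → Fin 3 → Fin 3 → ℤ)

/-- Second-factor block table; local notation. -/
local notation "𝔹v" => (
  ![![![1, 0, -1], ![-1, 0, 1], ![0, 0, 0]],
    ![![0, 0, 0], ![1, 0, -1], ![-1, 0, 1]],
    ![![-1, 0, 1], ![0, 0, 0], ![1, 0, -1]],
    ![![1, 0, -1], ![1, 0, -1], ![0, 0, 0]],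
    ![![0, 0, 0], ![1, 0, -1], ![1, 0, -1]],
    ![![0, 0, 0], ![0, 0, 0], ![-1, -1, 0]],
    ![![0, 0, 0], ![-1, -1, 0], ![0, 0, 0]],
    ![![-1, -1, -16], ![0, 0, 0], ![0, 0, 0]],
    ![![-2, -2, 0], ![-3, -3, 0], ![0, 0, 0]],
    ![![0, 0, 0], ![1, 1, 0], ![-1, -1, 32]],
    ![![0, 0, 0], ![-1, -1, -16], ![0, 0, 0]],
    ![![2, 2, 0], ![-9, -9, 0], ![6, 6, -192]],
    ![![1, 1, 48], ![0, 0, 0], ![3, 3, 48]],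
    ![![0, 0, 0], ![3, 3, -48], ![-2, -2, 96]]] : Fin 14 → Fin 3 → Fin 3 → ℤ)

/-- Third-factor block table; local notation. -/
local notation "𝔹w" => (
  ![![![1, 0, -1], ![1, 0, -1], ![0, 0, 0]],
    ![![0, 0, 0], ![1, 0, -1], ![1, 0, -1]],
    ![![1, 0, -1], ![0, 0, 0], ![1, 0, -1]],
    ![![-1, 0, 1], ![1, 0, -1], ![0, 0, 0]],
    ![![0, 0, 0], ![-1, 0, 1], ![1, 0, -1]],
    ![![2, 2, 64], ![-9, -9, -288], ![6, 6, 0]],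
    ![![2, 2, 0], ![3, 3, -432], ![0, 0, 192]],
    ![![0, 0, 0], ![-1, -1, -16], ![0, 0, -32]],
    ![![0, 0, 0], ![1, 1, 0], ![0, 0, 32]],
    ![![2, 2, 0], ![-3, -3, 0], ![6, 6, 0]],
    ![![1, 1, 16], ![0, 0, -216], ![0, 0, 48]],
    ![![0, 0, 0], ![0, 0, -72], ![-1, -1, 0]],
    ![![0, 0, 0], ![3, 3, 0], ![-2, -2, 0]],
    ![![-1, -1, 16], ![0, 0, 0], ![-3, -3, 0]]] : Fin 14 → Fin 3 → Fin 3 → ℤ)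

/-- The six permutations of `Fin 3` (column pattern `v ↦ ℙ6 π v`); local notation. -/
local notation "ℙ6" =>
  (![![0, 1, 2], ![0, 2, 1], ![1, 0, 2], ![1, 2, 0], ![2, 0, 1], ![2, 1, 0]] : Fin 6 → Fin 3 → Fin 3)

/-- Their signs; local notation. -/
local notation "𝕊6" => (![1, -1, -1, 1, 1, -1] : Fin 6 → ℤ)

set_option quotPrecheck false in
/-- Torus exponent of a position of the first two legs, `3·row + column`; local notation. -/
local notation "posExp" => (fun a : Fin 3 → Fin 3 => 3 * ((a 1 : Fin 3) : ℕ) + ((a 2 : Fin 3) : ℕ))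

set_option quotPrecheck false in
/-- Torus exponent of a position of the third leg (digits read through `γ`); local notation. -/
local notation "wExp" => (fun c : Fin 3 → Fin 3 => 3 * ((gam (c 1) : Fin 3) : ℕ) + ((gam (c 2) : Fin 3) : ℕ))

set_option quotPrecheck false in
/-- Integer coefficient of position `a` in the first leg of triad `(π, s)`; local notation. -/
local notation "uCoef" => (fun (π : Fin 6) (s : Fin 14) (a : Fin 3 → Fin 3) =>
  if a 2 = ℙ6 π (a 1) then 𝕊6 π * 𝔹u s (a 0) (a 1) else (0 : ℤ))

set_option quotPrecheck false in
/-- Integer coefficient of position `b` in the second leg of triad `(π, s)`; local notation. -/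
local notation "vCoef" => (fun (π : Fin 6) (s : Fin 14) (b : Fin 3 → Fin 3) =>
  if b 2 = ℙ6 π (b 1) then sgnB (b 0) * sgnB (b 1) * sgnB (b 2) * 𝔹v s (b 0) (b 1) else (0 : ℤ))

set_option quotPrecheck false in
/-- Integer coefficient of position `c` in the third leg of triad `(π, s)`; local notation. -/
local notation "wCoef" => (fun (π : Fin 6) (s : Fin 14) (c : Fin 3 → Fin 3) =>
  if gam (c 2) = ℙ6 π (gam (c 1)) then
    sgnC (c 0) * sgnC (c 1) * sgnC (c 2) * 𝔹w s (gam (c 0)) (gam (c 1)) else (0 : ℤ))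

set_option quotPrecheck false in
/-- Sum over all `84` triads of the integer coefficient at entry `(a,b,c)` (admissibility hoisted out of
the inner sum); local notation. -/
local notation "entrySum" => (fun (a b c : Fin 3 → Fin 3) =>
  (List.ofFn fun π : Fin 6 =>
    if (decide (a 2 = ℙ6 π (a 1)) && decide (b 2 = ℙ6 π (b 1)) &&
        decide (gam (c 2) = ℙ6 π (gam (c 1)))) = true then
      𝕊6 π * (sgnB (b 0) * sgnB (b 1) * sgnB (b 2)) * (sgnC (c 0) * sgnC (c 1) * sgnC (c 2)) *
        (List.ofFn fun s : Fin 14 =>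
          𝔹u s (a 0) (a 1) * 𝔹v s (b 0) (b 1) * 𝔹w s (gam (c 0)) (gam (c 1))).sum
    else (0 : ℤ)).sum)

set_option quotPrecheck false in
/-- Integer model of the entry of `T_{skewcw,2}^{⊠3}`; local notation. -/
local notation "targetZ" => (fun (a b c : Fin 3 → Fin 3) =>
  skewZ (a 0) (b 0) (c 0) * skewZ (a 1) (b 1) (c 1) * skewZ (a 2) (b 2) (c 2))

set_option quotPrecheck false in
/-- The per-entry certificate (degree `< 12`: cancellation; `= 12`: `576 ×` the target; target
concentrated in degree `12`); local notation. -/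
local notation "EntryOK" => (fun (a b c : Fin 3 → Fin 3) =>
  (posExp a + posExp b + wExp c < 12 → entrySum a b c = 0) ∧
    (posExp a + posExp b + wExp c = 12 → entrySum a b c = (576 : ℤ) * targetZ a b c) ∧
    (posExp a + posExp b + wExp c ≠ 12 → targetZ a b c = 0))

set_option quotPrecheck false in
/-- Boolean check of the `3⁸` entries with first `A`-digit `a0`; local notation. -/
local notation "skewCubeChunk84" => (fun a0 : Fin 3 =>
  (List.finRange 3).all fun a1 => (List.finRange 3).all fun a2 =>
  (List.finRange 3).all fun b0 => (List.finRange 3).all fun b1 => (List.finRange 3).all fun b2 =>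
  (List.finRange 3).all fun c0 => (List.finRange 3).all fun c1 => (List.finRange 3).all fun c2 =>
    decide (EntryOK ![a0, a1, a2] ![b0, b1, b2] ![c0, c1, c2]))

set_option maxHeartbeats 0 in
/-- Certificate chunk `a0 = 0` (integer arithmetic, `decide +kernel`). [new] -/
theorem skewCube84_chunk_zero : skewCubeChunk84 0 = true := by
  decide +kernel

set_option maxHeartbeats 0 in
/-- Certificate chunk `a0 = 1`. [new] -/
theorem skewCube84_chunk_one : skewCubeChunk84 1 = true := by
  decide +kernel

set_option maxHeartbeats 0 in
/-- Certificate chunk `a0 = 2`. [new] -/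
theorem skewCube84_chunk_two : skewCubeChunk84 2 = true := by
  decide +kernel

/-- All chunks. [new] -/
theorem skewCube84_chunk_all (a0 : Fin 3) : skewCubeChunk84 a0 = true := by
  fin_cases a0
  · exact skewCube84_chunk_zero
  · exact skewCube84_chunk_one
  · exact skewCube84_chunk_two

/-- The per-entry certificate for every entry of the `27³` cube. [new] -/
theorem skewCube84_entryOK (a b c : Fin 3 → Fin 3) : EntryOK a b c := by
  have h := skewCube84_chunk_all (a 0)
  simp only [List.all_eq_true, List.mem_finRange, true_implies, decide_eq_true_eq] at h
  have ha : (![a 0, a 1, a 2] : Fin 3 → Fin 3) = a := by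
    funext i; fin_cases i <;> rfl
  have hb : (![b 0, b 1, b 2] : Fin 3 → Fin 3) = b := by
    funext i; fin_cases i <;> rfl
  have hc : (![c 0, c 1, c 2] : Fin 3 → Fin 3) = c := by
    funext i; fin_cases i <;> rfl
  have := h (a 1) (a 2) (b 0) (b 1) (b 2) (c 0) (c 1) (c 2)
  rw [ha, hb, hc] at this
  exact this

/-- The coefficient of one triad factors through admissibility. [new] -/
theorem skewCube84_coef_mul_eq (π : Fin 6) (s : Fin 14) (a b c : Fin 3 → Fin 3) :
    uCoef π s a * vCoef π s b * wCoef π s c =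
      if (decide (a 2 = ℙ6 π (a 1)) && decide (b 2 = ℙ6 π (b 1)) &&
          decide (gam (c 2) = ℙ6 π (gam (c 1)))) = true then
        𝕊6 π * (sgnB (b 0) * sgnB (b 1) * sgnB (b 2)) * (sgnC (c 0) * sgnC (c 1) * sgnC (c 2)) *
          (𝔹u s (a 0) (a 1) * 𝔹v s (b 0) (b 1) * 𝔹w s (gam (c 0)) (gam (c 1)))
      else 0 := by
  by_cases h1 : a 2 = ℙ6 π (a 1) <;> by_cases h2 : b 2 = ℙ6 π (b 1) <;>
    by_cases h3 : gam (c 2) = ℙ6 π (gam (c 1)) <;>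
      simp only [h1, h2, h3, if_true, if_false, decide_true, decide_false, Bool.and_true, Bool.and_false,
        zero_mul, mul_zero, Bool.false_eq_true]
  ring

/-- The double sum of triad coefficients is the model's entry sum. [new] -/
theorem skewCube84_sum_coef_eq (a b c : Fin 3 → Fin 3) :
    (∑ π : Fin 6, ∑ s : Fin 14, uCoef π s a * vCoef π s b * wCoef π s c) = entrySum a b c := by
  simp only [List.sum_ofFn, skewCube84_coef_mul_eq]
  refine Finset.sum_congr rfl fun π _ => ?_
  split_ifs with h
  · rw [Finset.mul_sum]
  · simp

/-- `T_{skewcw,2}^{⊠3}` entrywise as a product of three integer casts. [new] -/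
theorem kroneckerPow_skewCwTensor_three (a b c : Fin 3 → Fin 3) :
    kroneckerPow (skewCwTensor ℂ 1) 3 a b c = ((targetZ a b c : ℤ) : ℂ) := by
  rw [kroneckerPow_apply, Fin.prod_univ_three, skewCwTensor_one_eq_cast, skewCwTensor_one_eq_cast,
    skewCwTensor_one_eq_cast]
  push_cast; ring

/-- `R_12(T_{skewcw,2}^{⊠3}) ≤ 84` in the sense of `approxRank`: the `84` monomial triads
`(uCoef/576)·t^{posExp} ⊗ vCoef·t^{posExp} ⊗ wCoef·t^{wExp}` (indexed by `Fin 6 × Fin 14`) form an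
order-`12` approximate decomposition. [new] -/
theorem approxRank_twelve_skewCw2_cube_le :
    approxRank 12 (kroneckerPow (skewCwTensor ℂ 1) 3) ≤ 84 :=
  approxRank_le_of_isApproxDecomposition
    (isApproxDecomposition_of_entrywise (h := 12)
      ((@finProdFinEquiv 6 14).symm : Fin 84 ≃ Fin 6 × Fin 14) uCoef vCoef wCoef posExp posExp wExp
      (576 : ℤ) (by norm_num) (kroneckerPow (skewCwTensor ℂ 1) 3) targetZ kroneckerPow_skewCwTensor_three
      (fun a b c hlt => by rw [skewCube84_sum_coef_eq]; exact (skewCube84_entryOK a b c).1 hlt)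
      (fun a b c heq => by rw [skewCube84_sum_coef_eq]; exact (skewCube84_entryOK a b c).2.1 heq)
      (fun a b c hne => (skewCube84_entryOK a b c).2.2 hne))

end SkewCube84

/-- **Theorem (new upper bound).** `bR(T_{skewcw,2}^{⊠3}) ≤ 84`; previously `49 ≤ bR ≤ 85 = 5·17`
[ConnerHuangLandsberg2020, Thm. 4.1; ConnerGesmundoLandsbergVentura2022, Thm. 2.7]. [new] -/
theorem algBorderRank_skewCw2_cube_le_84 :
    algBorderRank (kroneckerPow (skewCwTensor ℂ 1) 3) ≤ 84 :=
  (algBorderRank_le_approxRank 12 _).trans approxRank_twelve_skewCw2_cube_le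

/-- Strict sub-multiplicativity across the square: `bR(T^{⊠3}) ≤ 84 < 85 = bR(T) · 17`, using the landed
value `bR(T_{skewcw,2}) = 5` (`CGLV2022_prop31_holds`; `17 ≥ bR(T^{⊠2})` is
`CGLV2022_borderRank_skewCw2_sq_le_holds`). [new] -/
theorem algBorderRank_skewCw2_cube_lt :
    algBorderRank (kroneckerPow (skewCwTensor ℂ 1) 3) < algBorderRank (skewCwTensor ℂ 1) * 17 := by
  have h5 : algBorderRank (skewCwTensor ℂ 1) = 5 := CGLV2022_prop31_holds.2
  rw [h5]
  exact lt_of_le_of_lt algBorderRank_skewCw2_cube_le_84 (by norm_num)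

end Summit.MatrixMultiplication.MatrixMultiplication.Theorems
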